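/-
Copyright (c) 2026 the pub-hodgecm-mathlib formalisation cell (harness21).  Prover seat hodgecm-mathlib-F0P3a-p02 (g18): road «S3-ram», (Cnt2′) ROUTE B (chair
F0P3a-p07 (g15) RULING (13)(5), FINITE half of the anisotropic∕hyperbolic root collar census): the quartic-to-cubic character-sum transfer; 2026-09-02.
-/
import Literature.FieldTheory.FiniteFields.JacobsthalSums   -- ★ `jacobsthalSum` (Lidl–Niederreiter 5.49) — cited in the docstrings; brings Mathlib
import HarnessLib

/-!
# A quartic-to-cubic transfer of quadratic character sums through a conic (Lidl–Niederreiter Ch. 5 §4, Ch. 6 §2; Ireland–Rosen Ch. 8)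

Topic `FieldTheory/FiniteFields`; namespace `Literature.FieldTheory.FiniteFields.ConicTransfer`.  THEOREMS ONLY (no definition, no instance, no notation, no named fact,
no `sorry`); kernel lane `--supports stmt-HodgeConjecture-24833` (cell `pub/hodgecm-mathlib`, crux H413, road «S3-ram», count-neutral: the finite-field half of the type-(2)
root collar census, CENSUS NOTE v3 `F0/P3a/F0P3a-p02/g18/census/CENSUS-NOTE-blockRoot-proofBlueprint.v3.F0P3ap02g18.md`, STEP 5).

THE MATHEMATICS (`F` finite of odd characteristic, `η` the quadratic character, `d ≠ 0`, `e := a² + d·y² ≠ 0`).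
* §1 `sum_quadraticChar_fst_of_conic`: `Σ_{u² + d v² = e} η(u) = η(−d)·Σ_x η(x)·η(x² − e)` (a Jacobsthal sum `H₂(−e)`, [LN] Def. 5.49) — count the fibre `#{v : dv² = e − u²}
  = 1 + η(d(e − u²))`.
* §2 `sum_quadraticChar_linear_of_unitConic`: the linear map `(U,V) ↦ (aU + dyV, aV − yU)` (determinant `e`) multiplies the norm `U² + dV²` by `e`, so
  `Σ_{U² + dV² = 1} η(aU + dyV) = Σ_{u² + dv² = e} η(u)`.
* §3 `sum_quadraticChar_quartic_eq_sum_unitConic`: the rational parametrisation `x ↦ ((x² − d)∕(x² + d), 2x∕(x² + d))` of the unit conic minus `(1, 0)` turns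
  `η(a) + Σ_x η((x² + d)(a x² + 2dyx − ad))` into `Σ_{U² + dV² = 1} η(aU + dyV)` (the `x` with `x² = −d`, if any, contribute `η(0) = 0` and are exactly the non-parametrised
  values; the missing point `(1,0)` contributes `η(a)`).
* §4 **`quadraticChar_quartic_transfer`**: `η(a) + Σ_x η((x² + d)(a x² + 2dyx − ad)) = η(−d)·Σ_x η(x)η(x² − e)` — the identity that makes the Jacobsthal term of the two
  type-(2) root censuses (hyperbolic and anisotropic root planes) the SAME, so that it cancels in the block law (checked numerically on 14 124 cases, q ≤ 23).
HONEST LABEL: HC_CM is proved only modulo the 2 remaining named inputs (hLiu418 24832, h413 24833) until rung 0 closes; finite-field algebra only, nothing printed is asserted.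

## References
* [LidlNiederreiter1996] R. Lidl, H. Niederreiter, *Finite Fields*, 2nd ed., Ch. 5 §4 (Def. 5.49 Jacobsthal sums, (5.68), Thm. 5.50), Ch. 6 §2 (Thm. 6.26∕6.27: points on conics).
* [IrelandRosen1990] K. Ireland, M. Rosen, *A Classical Introduction to Modern Number Theory*, GTM 84, Ch. 8 §1–§3 (quadratic character sums, Jacobi sums).
-/

set_option autoImplicit false

namespace Literature.FieldTheory.FiniteFields.ConicTransfer

open Finset

variable {F : Type*} [Field F] [Fintype F] [DecidableEq F]

/-! ## §0 Counting square roots -/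

/-- `#{v : v² = b} = 1 + η(b)` (`b` arbitrary; odd characteristic). [cite: LidlNiederreiter1996, Ch. 5 §4 (proof of Thm. 5.50)] -/
theorem card_filter_sq_eq (hF : ringChar F ≠ 2) (b : F) : ((univ.filter fun v : F => v ^ 2 = b).card : ℤ) = 1 + quadraticChar F b := by
  by_cases hb : b = 0
  · subst hb
    have h : (univ.filter fun v : F => v ^ 2 = 0) = {0} := by
      ext v; simp [pow_eq_zero_iff]
    rw [h, Finset.card_singleton, quadraticChar_zero]; norm_num
  · by_cases hsq : IsSquare b
    · obtain ⟨r, hr⟩ := hsq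
      have hr0 : r ≠ 0 := fun h0 => hb (by rw [hr, h0, mul_zero])
      have hne : r ≠ -r := fun h => hr0 (by
        have h2 : (2 : F) * r = 0 := by linear_combination h
        rcases mul_eq_zero.1 h2 with h2' | h2'
        · exact absurd h2' (Ring.two_ne_zero hF)
        · exact h2')
      have h : (univ.filter fun v : F => v ^ 2 = b) = {r, -r} := by
        ext v
        simp only [Finset.mem_filter, Finset.mem_univ, true_and, Finset.mem_insert, Finset.mem_singleton]
        constructor
        · intro hv
          have h0 : (v - r) * (v + r) = 0 := by rw [hr] at hv; linear_combination hv
          rcases mul_eq_zero.1 h0 with h1 | h1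
          · left; linear_combination h1
          · right; linear_combination h1
        · rintro (rfl | rfl) <;> rw [hr] <;> ring
      rw [h, Finset.card_insert_of_notMem (by simpa using hne), Finset.card_singleton, (quadraticChar_one_iff_isSquare hb).2 ⟨r, hr⟩]; norm_num
    · have h : (univ.filter fun v : F => v ^ 2 = b) = ∅ := by
        rw [Finset.filter_eq_empty_iff]; intro v _ hv; exact hsq ⟨v, by rw [← hv]; ring⟩
      rw [h, Finset.card_empty, quadraticChar_neg_one_iff_not_isSquare.2 hsq]; norm_num

/-! ## §1 The conic of norm `e`: `Σ η(u)` is a Jacobsthal sum -/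

/-- **`Σ_{u² + dv² = e} η(u) = η(−d)·Σ_x η(x)·η(x² − e)`** (`d ≠ 0`, any `e`): fibrewise `#{v : dv² = e − u²} = 1 + η(d(e − u²))` and `Σ_u η(u) = 0`.
[cite: LidlNiederreiter1996, Ch. 5 §4 Def. 5.49] [cite: IrelandRosen1990, Ch. 8 §1] -/
theorem sum_quadraticChar_fst_of_conic (hF : ringChar F ≠ 2) {d : F} (hd : d ≠ 0) (e : F) :
    ∑ p ∈ univ.filter (fun p : F × F => p.1 ^ 2 + d * p.2 ^ 2 = e), quadraticChar F p.1 =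
      quadraticChar F (-d) * ∑ x : F, quadraticChar F x * quadraticChar F (x ^ 2 - e) := by
  -- sum over `u` of `η(u) · #{v : d v² = e − u²}`
  have hfib : ∀ u : F, ((univ.filter fun v : F => u ^ 2 + d * v ^ 2 = e).card : ℤ) = 1 + quadraticChar F (d * (e - u ^ 2)) := by
    intro u
    have hset : (univ.filter fun v : F => u ^ 2 + d * v ^ 2 = e) = univ.filter fun v : F => v ^ 2 = d⁻¹ * (e - u ^ 2) := by
      refine Finset.filter_congr fun v _ => ⟨fun h => ?_, fun h => ?_⟩
      · rw [← h]; field_simp; ring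
      · rw [h]; field_simp; ring
    rw [hset, card_filter_sq_eq hF, show d⁻¹ * (e - u ^ 2) = d * (e - u ^ 2) * d⁻¹ ^ 2 by field_simp, map_mul, map_pow,
      quadraticChar_sq_one (inv_ne_zero hd), mul_one]
  have hstep : ∀ u : F, ((univ.filter fun v : F => u ^ 2 + d * v ^ 2 = e).card : ℤ) * quadraticChar F u =
      quadraticChar F u + quadraticChar F (-d) * (quadraticChar F u * quadraticChar F (u ^ 2 - e)) := by
    intro u
    rw [hfib u, show d * (e - u ^ 2) = -d * (u ^ 2 - e) by ring, map_mul]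
    ring
  have hinner : ∀ u : F, ∑ v : F, (if u ^ 2 + d * v ^ 2 = e then quadraticChar F u else 0) =
      ((univ.filter fun v : F => u ^ 2 + d * v ^ 2 = e).card : ℤ) * quadraticChar F u := by
    intro u
    rw [Finset.sum_ite, Finset.sum_const_zero, add_zero, Finset.sum_const, nsmul_eq_mul]
  rw [Finset.sum_filter, Fintype.sum_prod_type]
  dsimp only
  simp_rw [hinner, hstep, Finset.sum_add_distrib, quadraticChar_sum_zero hF, zero_add, ← Finset.mul_sum]

/-! ## §2 The norm-multiplying linear substitution -/

/-- **`Σ_{U² + dV² = 1} η(aU + dyV) = Σ_{u² + dv² = e} η(u)`**, `e = a² + dy² ≠ 0`: the linear map `(U,V) ↦ (aU + dyV, aV − yU)` has determinant `e` and satisfies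
`(aU + dyV)² + d(aV − yU)² = e·(U² + dV²)`. [cite: IrelandRosen1990, Ch. 8 §3] [cite: LidlNiederreiter1996, Ch. 6 §2] -/
theorem sum_quadraticChar_linear_of_unitConic (d a y : F) (he : a ^ 2 + d * y ^ 2 ≠ 0) :
    ∑ p ∈ univ.filter (fun p : F × F => p.1 ^ 2 + d * p.2 ^ 2 = 1), quadraticChar F (a * p.1 + d * y * p.2) =
      ∑ p ∈ univ.filter (fun p : F × F => p.1 ^ 2 + d * p.2 ^ 2 = a ^ 2 + d * y ^ 2), quadraticChar F p.1 := by
  refine Finset.sum_bij (fun p _ => (a * p.1 + d * y * p.2, a * p.2 - y * p.1)) (fun p hp => ?_) (fun p₁ hp₁ p₂ hp₂ h => ?_) (fun p hp => ?_) (fun p hp => rfl)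
  · rw [Finset.mem_filter] at hp ⊢
    refine ⟨Finset.mem_univ _, ?_⟩
    have h := hp.2
    linear_combination (a ^ 2 + d * y ^ 2) * h
  · obtain ⟨h1, h2⟩ := Prod.ext_iff.1 h
    simp only at h1 h2
    -- invert the linear map (determinant `e ≠ 0`)
    have hu : (a ^ 2 + d * y ^ 2) * p₁.1 = (a ^ 2 + d * y ^ 2) * p₂.1 := by linear_combination a * h1 - d * y * h2
    have hv : (a ^ 2 + d * y ^ 2) * p₁.2 = (a ^ 2 + d * y ^ 2) * p₂.2 := by linear_combination y * h1 + a * h2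
    exact Prod.ext (mul_left_cancel₀ he hu) (mul_left_cancel₀ he hv)
  · rw [Finset.mem_filter] at hp
    refine ⟨((a * p.1 - d * y * p.2) / (a ^ 2 + d * y ^ 2), (a * p.2 + y * p.1) / (a ^ 2 + d * y ^ 2)), ?_, ?_⟩
    · rw [Finset.mem_filter]
      refine ⟨Finset.mem_univ _, ?_⟩
      show ((a * p.1 - d * y * p.2) / (a ^ 2 + d * y ^ 2)) ^ 2 + d * ((a * p.2 + y * p.1) / (a ^ 2 + d * y ^ 2)) ^ 2 = 1
      rw [div_pow, div_pow, mul_div_assoc', ← add_div, div_eq_one_iff_eq (pow_ne_zero 2 he)]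
      linear_combination (a ^ 2 + d * y ^ 2) * hp.2
    · refine Prod.ext ?_ ?_
      · show a * ((a * p.1 - d * y * p.2) / (a ^ 2 + d * y ^ 2)) + d * y * ((a * p.2 + y * p.1) / (a ^ 2 + d * y ^ 2)) = p.1
        rw [mul_div_assoc', mul_div_assoc', ← add_div, div_eq_iff he]
        ring
      · show a * ((a * p.2 + y * p.1) / (a ^ 2 + d * y ^ 2)) - y * ((a * p.1 - d * y * p.2) / (a ^ 2 + d * y ^ 2)) = p.2
        rw [mul_div_assoc', mul_div_assoc', ← sub_div, div_eq_iff he]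
        ring

/-! ## §3 The rational parametrisation of the unit conic -/

/-- **`η(a) + Σ_x η((x² + d)(a x² + 2dyx − ad)) = Σ_{U² + dV² = 1} η(aU + dyV)`** (`d ≠ 0`, odd characteristic): `x ↦ ((x² − d)∕(x² + d), 2x∕(x² + d))` is a bijection
from `{x : x² + d ≠ 0}` onto the unit conic minus `(1, 0)`, carrying `η((x² + d)(ax² + 2dyx − ad)) = η((x² + d)²·(aU + dyV))` to `η(aU + dyV)`; the excluded `x` contribute
`η(0) = 0` and the point `(1, 0)` contributes `η(a)`. [cite: LidlNiederreiter1996, Ch. 6 §2 Thm. 6.26] [cite: IrelandRosen1990, Ch. 8 §3] -/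
theorem sum_quadraticChar_quartic_eq_sum_unitConic (hF : ringChar F ≠ 2) {d : F} (hd : d ≠ 0) (a y : F) :
    quadraticChar F a + ∑ x : F, quadraticChar F ((x ^ 2 + d) * (a * x ^ 2 + 2 * d * y * x - a * d)) =
      ∑ p ∈ univ.filter (fun p : F × F => p.1 ^ 2 + d * p.2 ^ 2 = 1), quadraticChar F (a * p.1 + d * y * p.2) := by
  have h20 : (2 : F) ≠ 0 := Ring.two_ne_zero hF
  have hne_one : ∀ x : F, x ^ 2 + d ≠ 0 → (x ^ 2 - d) / (x ^ 2 + d) ≠ 1 := by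
    intro x hx h1
    rw [div_eq_one_iff_eq hx] at h1
    have h2d : 2 * d = 0 := by linear_combination -h1
    rcases mul_eq_zero.1 h2d with h | h
    · exact h20 h
    · exact hd h
  -- drop the `x` with `x² + d = 0` (their term is `η 0 = 0`)
  have hzero : ∑ x ∈ univ.filter (fun x : F => ¬ (x ^ 2 + d ≠ 0)), quadraticChar F ((x ^ 2 + d) * (a * x ^ 2 + 2 * d * y * x - a * d)) = 0 := by
    refine Finset.sum_eq_zero fun x hx => ?_
    rw [Finset.mem_filter, not_not] at hx
    rw [hx.2, zero_mul, quadraticChar_zero]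
  have hsplit : ∑ x : F, quadraticChar F ((x ^ 2 + d) * (a * x ^ 2 + 2 * d * y * x - a * d)) =
      ∑ x ∈ univ.filter (fun x : F => x ^ 2 + d ≠ 0), quadraticChar F ((x ^ 2 + d) * (a * x ^ 2 + 2 * d * y * x - a * d)) := by
    rw [← Finset.sum_filter_add_sum_filter_not univ (fun x : F => x ^ 2 + d ≠ 0), hzero, add_zero]
  -- the point `(1,0)` and the rest of the conic
  have hmem : ((1 : F), (0 : F)) ∈ univ.filter (fun p : F × F => p.1 ^ 2 + d * p.2 ^ 2 = 1) := by
    rw [Finset.mem_filter]; exact ⟨Finset.mem_univ _, by ring⟩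
  rw [hsplit, ← Finset.add_sum_erase _ _ hmem, mul_one, mul_zero, add_zero]
  congr 1
  -- the bijection `x ↦ ((x² − d)/(x² + d), 2x/(x² + d))`
  refine Finset.sum_bij (fun x _ => ((x ^ 2 - d) / (x ^ 2 + d), 2 * x / (x ^ 2 + d))) (fun x hx => ?_) (fun x₁ hx₁ x₂ hx₂ h => ?_) (fun p hp => ?_)
    (fun x hx => ?_)
  · rw [Finset.mem_filter] at hx
    rw [Finset.mem_erase, Finset.mem_filter]
    refine ⟨fun h => hne_one x hx.2 (Prod.ext_iff.1 h).1, Finset.mem_univ _, ?_⟩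
    show ((x ^ 2 - d) / (x ^ 2 + d)) ^ 2 + d * (2 * x / (x ^ 2 + d)) ^ 2 = 1
    rw [div_pow, div_pow, mul_div_assoc', ← add_div, div_eq_one_iff_eq (pow_ne_zero 2 hx.2)]
    ring
  · rw [Finset.mem_filter] at hx₁ hx₂
    obtain ⟨h1, h2⟩ := Prod.ext_iff.1 h
    simp only at h1 h2
    -- `x = d·V/(1 − U)` recovers `x`
    have key : ∀ x : F, x ^ 2 + d ≠ 0 → d * (2 * x / (x ^ 2 + d)) = x * (1 - (x ^ 2 - d) / (x ^ 2 + d)) := fun x hx => by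
      field_simp; ring
    have hne1 : (1 : F) - (x₂ ^ 2 - d) / (x₂ ^ 2 + d) ≠ 0 := sub_ne_zero.2 (Ne.symm (hne_one x₂ hx₂.2))
    have e1 := key x₁ hx₁.2
    rw [h1, h2, key x₂ hx₂.2] at e1
    exact (mul_right_cancel₀ hne1 e1).symm
  · rw [Finset.mem_erase, Finset.mem_filter] at hp
    obtain ⟨hp1, -, hpc⟩ := hp
    have hU : 1 - p.1 ≠ 0 := by
      intro h0
      have hp1' : p.1 = 1 := by linear_combination -h0
      have hp2 : d * p.2 ^ 2 = 0 := by rw [hp1'] at hpc; linear_combination hpc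
      rcases mul_eq_zero.1 hp2 with h | h
      · exact hd h
      · exact hp1 (Prod.ext hp1' (pow_eq_zero_iff two_ne_zero |>.1 h))
    set x : F := d * p.2 / (1 - p.1) with hxval
    have hxdef : x * (1 - p.1) = d * p.2 := div_mul_cancel₀ _ hU
    have h1 : x ^ 2 * (1 - p.1) * (1 - p.1) = d * (1 + p.1) * (1 - p.1) := by
      linear_combination (x * (1 - p.1) + d * p.2) * hxdef + d * hpc
    have h2 : x ^ 2 * (1 - p.1) = d * (1 + p.1) := mul_right_cancel₀ hU h1
    have h2d : (x ^ 2 + d) * (1 - p.1) = 2 * d := by linear_combination h2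
    have hx0 : x ^ 2 + d ≠ 0 := fun h0 => by
      rw [h0, zero_mul] at h2d
      exact mul_ne_zero h20 hd h2d.symm
    refine ⟨x, ?_, ?_⟩
    · rw [Finset.mem_filter]; exact ⟨Finset.mem_univ _, hx0⟩
    · refine Prod.ext ?_ ?_
      · show (x ^ 2 - d) / (x ^ 2 + d) = p.1
        rw [div_eq_iff hx0]
        linear_combination h2d
      · show 2 * x / (x ^ 2 + d) = p.2
        rw [div_eq_iff hx0]
        refine mul_right_cancel₀ hU ?_
        linear_combination 2 * hxdef - p.2 * h2d
  · -- the value transforms by the square `(x² + d)²`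
    rw [Finset.mem_filter] at hx
    have hsq : (x ^ 2 + d) * (a * x ^ 2 + 2 * d * y * x - a * d) =
        (a * ((x ^ 2 - d) / (x ^ 2 + d)) + d * y * (2 * x / (x ^ 2 + d))) * (x ^ 2 + d) ^ 2 := by
      field_simp
      ring
    rw [hsq, map_mul, map_pow, quadraticChar_sq_one hx.2, mul_one]

/-! ## §4 The transfer identity -/

/-- **THE QUARTIC-TO-CUBIC TRANSFER.**  For `d ≠ 0`, `e := a² + dy² ≠ 0` (odd characteristic):
`η(a) + Σ_x η((x² + d)(a x² + 2dyx − ad)) = η(−d)·Σ_x η(x)·η(x² − e)` (the right-hand sum is the Jacobsthal sum `H₂(−e)`, ★ `jacobsthalSum 2 (-e)` up to spelling). This is the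
identity behind the type-(2) root collar census: the class split of the root lines of BOTH literals carries the same Jacobsthal term. [cite: LidlNiederreiter1996, Ch. 5 §4 Def. 5.49]
[cite: IrelandRosen1990, Ch. 8 §3] -/
theorem quadraticChar_quartic_transfer (hF : ringChar F ≠ 2) {d : F} (hd : d ≠ 0) (a y : F) (he : a ^ 2 + d * y ^ 2 ≠ 0) :
    quadraticChar F a + ∑ x : F, quadraticChar F ((x ^ 2 + d) * (a * x ^ 2 + 2 * d * y * x - a * d)) =
      quadraticChar F (-d) * ∑ x : F, quadraticChar F x * quadraticChar F (x ^ 2 - (a ^ 2 + d * y ^ 2)) := by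
  rw [sum_quadraticChar_quartic_eq_sum_unitConic hF hd a y, sum_quadraticChar_linear_of_unitConic d a y he, sum_quadraticChar_fst_of_conic hF hd]

end Literature.FieldTheory.FiniteFields.ConicTransfer
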